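import Literature.AlgebraicGeometry.ShimuraVarieties.UnitaryCurveSiegelPointMap
import Literature.AlgebraicGeometry.ModuliOfAbelianVarieties.SiegelModuliComplexUniformisation
import HarnessLib

/-!
# The Siegel chart of the unitary Shimura curve on Mumford's fine moduli scheme (E3 instantiated at the (U) fact)

Topic `AlgebraicGeometry/ShimuraVarieties`; namespace `Literature.AlgebraicGeometry.ShimuraVarieties.UnitaryCurve`.
THEOREMS ONLY (no `def`, no named fact, no instance, no `sorry`).  Cell `hodgecm-mathlib`, crux HLiu418 (stmt-HodgeConjecture-24832),
sub-line P6a, E-line `F0_P6a_PELWitnessE` (GEN heir A-p18 (g31), ED. 1 `Cruxes/HLiu418/Lines/F0_P6a_PELWitnessE.lean` 217c60bf), organ E3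
FILE C (LEAD F0P6-plan (g2) DEAL 2026-09-01T22:05:38Z (i)): ★ `UnitaryCurve.exists_moduliPointMapGS` (FILE A, over ABSTRACT uniformised pieces)
INSTANTIATED at the complex-analytic uniformisation fact (U) ★ `siegelModuli_complexUniformisation` of Mumford's fine moduli scheme
`𝓜 : SiegelFineModuliScheme g N δ` ([MumfordFogartyKirwan1994] App. 7A, [Deligne1971TravauxShimura] 4.11–4.12, [Milne2005ShimuraVarieties] Thm. 6.11), and
joined with its junction clause (U3): the Siegel-side fields `Sc ιc unif isColimit_ιc unif_hol` (+ `unif_cont`, `unif_open`, irreducibility),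
the point-map fields `f piece Z Z_hol Z_mem f_mk` of the E-line's `AuxChartGS` IN ITS TOKEN SHAPES (`f` valued in the `ℚ`-structure points
`𝓜.M(ℂ)`, `f_mk` read through ★ `AlgPoints.baseChangeEquiv (algebraMap ℚ ℂ) 𝓜.M`), the admissibility field `f_admissible` ((U3∃) at
`(piece a, u, rep, Z a v)`) and the classification of the image points ((U3-D3): every triple admissible for `(Z a v, rep (piece a))` is classified
by `f [v, aK]`), together with the principal representatives and the Shimura-set shadow `pts (f [v, aK]) = [J(v), b(a)]` that carries the
injectivity questions (★ `UnitaryCurveSiegelPointSeparation`).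

Hypotheses = FILE A's datum `(J, b, bq)` on the negative cone with E2's period chart `hZ` (abstract-`γ` currency), a source level `K ≤ b⁻¹(K_δ(N))`,
and `(hU : siegelModuli_complexUniformisation)` — the (U) fact BY NAME (proved in the cell: `Theorems/HCCMUnconditionalSiegelDebtClosers.siegelModuli_complexUniformisation_holds`;
a Literature file cannot import it, so it is a binder here and GEN discharges it by name).

* `exists_siegelChartGS` — THE CHART (all of the above in one existential, field by field).

HC_CM is proved only modulo the 2 remaining named inputs (hLiu418 24832, h413 24833) until rung 0 closes; this file discharges neither
(count-neutral support of 24832).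

## References
* [MumfordFogartyKirwan1994] D. Mumford, J. Fogarty, F. Kirwan, *Geometric Invariant Theory* (3rd ed. 1994), Appendix to Ch. 7 §A pp. 234–235.
* [Deligne1971TravauxShimura] P. Deligne, *Travaux de Shimura* (1971), Prop. 1.15 p. 132, 4.11–4.12 pp. 148–149, Exemple 4.16 p. 150.
* [Deligne1979ShimuraVarieties] P. Deligne, *Variétés de Shimura* (1979), Prop. 2.3.10.
* [Milne2005ShimuraVarieties] J. S. Milne, *Introduction to Shimura varieties* (2005), Lemma 5.13 p. 57, Thm. 5.16–5.17, §6 Thm. 6.11 p. 74 and (63) p. 116.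
* [RapoportSmithlingZhang2020Diagonal] M. Rapoport, B. Smithling, W. Zhang (2020), §3.2 and Prop. 3.7 (proof) pp. 11–14.
-/

set_option autoImplicit false

noncomputable section

open Function Matrix NumberField IsDedekindDomain CategoryTheory CategoryTheory.Limits AlgebraicGeometry
open scoped Matrix ComplexOrder
open Literature.AlgebraicGeometry.Motives (SchemeOver ComplexPoints AlgPoints specOver)
open Literature.AlgebraicGeometry.AbelianSchemes (PolarizedAbelianSchemeWithLevel)
open Literature.NumberTheory.Automorphic (siegelUpperHalfSpace)
open Literature.NumberTheory.Automorphic.UnitaryGroup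
open Literature.AlgebraicGeometry.ModuliOfAbelianVarieties
open Literature.AlgebraicGeometry.ModuliOfAbelianVarieties.SiegelModuli (C0 jOfSiegel jOfSiegel_mem_C0)

namespace Literature.AlgebraicGeometry.ShimuraVarieties

open UnitaryCanonicalModel

namespace UnitaryCurve

variable {L : Type} [Field L] [NumberField L] [IsCMField L] {Jstar : Matrix (Fin 2) (Fin 2) L} {τ : L →+* ℂ}
variable {g : ℕ} {δ : Fin g → ℕ} {N : ℕ}

/-- **THE SIEGEL CHART OF THE UNITARY SHIMURA CURVE ON MUMFORD'S FINE MODULI SCHEME.**  For a Hodge-embedding datum `(J, b, bq)` on the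
negative cone of `J⋆^τ` (★ FILE A: `hJ hJneg hJsmul hb hJrat`, E2's period chart `hZ`), a source level `K ≤ b⁻¹(K_δ(N))`, a Siegel fine moduli
scheme `𝓜 : SiegelFineModuliScheme g N δ` (`0 < g`, `δ` a polarisation type, `N ≥ 3`) and the uniformisation fact (U) `hU`, there are: the (U1)
pieces `Sc c ⟶ 𝓜.M ⊗_ℚ ℂ` (`c ∈ (ℤ/N)ˣ`, a coproduct cofan of irreducible pieces) with their (U2+) uniformisations `unif c : 𝔥_g → (Sc c)(ℂ)`
(continuous, open, onto, `Γ_δ(N)`-fibred, holomorphic in affine algebraic coordinates); a point map `f : Sh_K(U(J⋆), 𝔻)(ℂ) → 𝓜.M(ℂ)` with piece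
function `piece`, PERIOD FUNCTIONS `Z a` (entrywise holomorphic and `𝔥_g`-valued on the negative cone), principal representatives `u_c`,
`rep c = diag(1, u_c·1) ∈ K_δ(1)` and a bijection `pts : (𝓜.M ⊗ ℂ)(ℂ) ≃ Sh_{K_δ(N)}(ℂ)`, such that
`f [v, aK] = bc⁻¹ ((ιc (piece a))(ℂ)(unif (piece a) (Z a v)))` (`bc` = ★ `AlgPoints.baseChangeEquiv (algebraMap ℚ ℂ) 𝓜.M`; the `f_mk` field of
`AuxChartGS`), `pts (bc (f [v, aK])) = [J(v), b(a)] = [J(Z a v), rep (piece a)]`, `pts ((ιc c)(ℂ)(unif c W)) = [J(W), rep c]`; the universal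
triple pulled back to `f [v, aK]` is ADMISSIBLE for `(Z a v, rep (piece a))` ((U3∃); the `f_admissible` field); and every triple over `Spec ℂ`
admissible for `(Z a v, rep (piece a))` is CLASSIFIED by `f [v, aK]` ((U3-D3)).  Assembly of ★ `exists_moduliPointMapGS` with the clauses of `hU`
at `𝓜`. [cite: MumfordFogartyKirwan1994, Appendix to Ch. 7 §A pp. 234–235] [cite: Deligne1971TravauxShimura, 4.11–4.12 pp. 148–149 and Prop. 1.15 p. 132]
[cite: Milne2005ShimuraVarieties, Thm. 6.11 p. 74, Lemma 5.13 p. 57, Thm. 5.16] [cite: Deligne1979ShimuraVarieties, Prop. 2.3.10] -/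
theorem exists_siegelChartGS (hU : siegelModuli_complexUniformisation) (hg : 0 < g) (hδ : IsPolarizationType δ) (hN : 3 ≤ N)
    (𝓜 : SiegelFineModuliScheme g N δ)
    (J : (Fin 2 → ℂ) → Matrix (Fin g ⊕ Fin g) (Fin g ⊕ Fin g) ℝ)
    (hJ : ∀ v : Fin 2 → ℂ, v ∈ negCone (Jstar.map τ) → J v ∈ C0pm δ)
    (hJneg : ∀ v : Fin 2 → ℂ, v ∈ negCone (Jstar.map τ) → -J v ∈ C0 δ)
    (hJsmul : ∀ c : ℂ, c ≠ 0 → ∀ v : Fin 2 → ℂ, v ∈ negCone (Jstar.map τ) → J (c • v) = J v)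
    (b : ↥(finAdelic (↥(maximalRealSubfield L)) L (IsCMField.complexConj L) 2 Jstar) →* ↥(gspFinAdelic δ))
    (bq : ↥(rational (↥(maximalRealSubfield L)) L (IsCMField.complexConj L) 2 Jstar) →* ↥(gspRational δ))
    (hb : ∀ γ : ↥(rational (↥(maximalRealSubfield L)) L (IsCMField.complexConj L) 2 Jstar),
      b (rationalToFinAdelic (↥(maximalRealSubfield L)) L (IsCMField.complexConj L) 2 Jstar γ) = gspRationalToFinAdelic δ (bq γ))
    (hJrat : ∀ (γ : ↥(rational (↥(maximalRealSubfield L)) L (IsCMField.complexConj L) 2 Jstar)) (v : Fin 2 → ℂ),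
      v ∈ negCone (Jstar.map τ) →
        J (((ratToGLℂ L Jstar τ γ : GL (Fin 2) ℂ) : Matrix (Fin 2) (Fin 2) ℂ) *ᵥ v) =
          conjJ ((gspRationalToReal δ (bq γ) : ↥(gspReal δ)) : GL (Fin g ⊕ Fin g) ℝ) (J v))
    (K : Subgroup ↥(finAdelic (↥(maximalRealSubfield L)) L (IsCMField.complexConj L) 2 Jstar))
    (hle : K ≤ (principalLevelSubgroup δ N).comap b)
    (hZ : ∀ γ : GL (Fin g ⊕ Fin g) ℝ, γ ∈ gspReal δ → (∀ v : Fin 2 → ℂ, v ∈ negCone (Jstar.map τ) → conjJ γ (J v) ∈ C0 δ) →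
      ∃ Z : (Fin 2 → ℂ) → Matrix (Fin g) (Fin g) ℂ,
        (∀ i j : Fin g, DifferentiableOn ℂ (fun v => Z v i j) (negCone (Jstar.map τ))) ∧
          ∀ v : Fin 2 → ℂ, v ∈ negCone (Jstar.map τ) → Z v ∈ siegelUpperHalfSpace g ∧ conjJ γ (J v) = jOfSiegel δ (Z v)) :
    haveI : IsLocallyNoetherian (specOver ℚ ℂ).left := inferInstanceAs (IsLocallyNoetherian (Spec (CommRingCat.of ℂ)))
    ∃ (Sc : (ZMod N)ˣ → SchemeOver ℂ) (ιc : ∀ c, Sc c ⟶ (Motives.baseChange ℚ ℂ).obj 𝓜.M)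
      (unif : ∀ _c : (ZMod N)ˣ, Matrix (Fin g) (Fin g) ℂ → ComplexPoints (Sc _c))
      (f : ShimuraSetGS L Jstar τ K → ComplexPoints 𝓜.M)
      (piece : ↥(finAdelic (↥(maximalRealSubfield L)) L (IsCMField.complexConj L) 2 Jstar) → (ZMod N)ˣ)
      (Z : ↥(finAdelic (↥(maximalRealSubfield L)) L (IsCMField.complexConj L) 2 Jstar) → (Fin 2 → ℂ) → Matrix (Fin g) (Fin g) ℂ)
      (u : (ZMod N)ˣ → finAdeleQˣ) (rep : (ZMod N)ˣ → ↥(gspFinAdelic δ))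
      (pts : ComplexPoints ((Motives.baseChange ℚ ℂ).obj 𝓜.M) ≃ SiegelShimuraSet δ (principalLevelSubgroup δ N)),
    -- (U1) component cofan of irreducible pieces
      Nonempty (IsColimit (Cofan.mk ((Motives.baseChange ℚ ℂ).obj 𝓜.M) ιc)) ∧
      (∀ c, IrreducibleSpace (Sc c).left) ∧
    -- (U2+) analytic clauses per piece
      (∀ c, ContinuousOn (unif c) (siegelUpperHalfSpace g)) ∧
      (∀ c, IsOpenMap ((siegelUpperHalfSpace g).restrict (unif c))) ∧
      (∀ c, Set.SurjOn (unif c) (siegelUpperHalfSpace g) Set.univ) ∧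
      (∀ c, ∀ W ∈ siegelUpperHalfSpace g, ∀ W' ∈ siegelUpperHalfSpace g,
        unif c W = unif c W' ↔ ∃ M ∈ siegelLevelGroup δ N, ∃ C : (Fin g → ℂ) ≃ₗ[ℂ] (Fin g → ℂ),
          ∀ x : Fin g ⊕ Fin g → ℝ, C (siegelPeriodMap δ W x) = siegelPeriodMap δ W' (intAct M x)) ∧
      (∀ (c : (ZMod N)ˣ) (U : (Sc c).left.affineOpens) (s : (Sc c).left.presheaf.obj (Opposite.op (↑U : (Sc c).left.Opens))),
        DifferentiableOn ℂ (fun W ↦ AlgPoints.evalOrZero (↑U : (Sc c).left.Opens) s (unif c W))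
          (siegelUpperHalfSpace g ∩ unif c ⁻¹' {P | P.pt ∈ (↑U : (Sc c).left.Opens)})) ∧
    -- principal representatives (the five (U3) premisses)
      (∀ c, (∀ w, Valued.v ((u c : finAdeleQ) w) = 1) ∧ (u c : finAdeleQ) - ((c : ZMod N).val : ℕ) ∈ levelIdeal N ∧
        rep c ∈ principalLevelSubgroup δ 1 ∧
          IsMultiplier (typeFormOver δ finAdeleQ) (rep c : GL (Fin g ⊕ Fin g) finAdeleQ) (u c) ∧
            ((rep c : GL (Fin g ⊕ Fin g) finAdeleQ) : Matrix (Fin g ⊕ Fin g) (Fin g ⊕ Fin g) finAdeleQ) =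
              Matrix.fromBlocks 1 0 0 ((u c : finAdeleQ) • (1 : Matrix (Fin g) (Fin g) finAdeleQ))) ∧
    -- (P) the point map: `Z_hol`, `Z_mem`, `f_mk`, the Shimura-set shadow
      (∀ a (i j : Fin g), DifferentiableOn ℂ (fun v => Z a v i j) (negCone (Jstar.map τ))) ∧
      (∀ a (v : Fin 2 → ℂ), v ∈ negCone (Jstar.map τ) → Z a v ∈ siegelUpperHalfSpace g) ∧
      (∀ (v : Fin 2 → ℂ) (hv : v ∈ negCone (Jstar.map τ)) a,
        f (ShimuraSetGS.mk L Jstar τ K v hv a) =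
          (AlgPoints.baseChangeEquiv (algebraMap ℚ ℂ) 𝓜.M).symm (AlgPoints.map (ιc (piece a)) (unif (piece a) (Z a v)))) ∧
      (∀ (v : Fin 2 → ℂ) (hv : v ∈ negCone (Jstar.map τ)) a,
        pts (AlgPoints.baseChangeEquiv (algebraMap ℚ ℂ) 𝓜.M (f (ShimuraSetGS.mk L Jstar τ K v hv a))) =
          SiegelShimuraSet.mk δ (principalLevelSubgroup δ N) ⟨J v, hJ v hv⟩ (b a)) ∧
      (∀ (v : Fin 2 → ℂ) (hv : v ∈ negCone (Jstar.map τ)) a, ∃ hZv : Z a v ∈ siegelUpperHalfSpace g,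
        SiegelShimuraSet.mk δ (principalLevelSubgroup δ N) ⟨J v, hJ v hv⟩ (b a) =
          SiegelShimuraSet.mk δ (principalLevelSubgroup δ N)
            ⟨jOfSiegel δ (Z a v), C0_subset_C0pm δ (jOfSiegel_mem_C0 hδ.1 hZv)⟩ (rep (piece a))) ∧
      (∀ (c : (ZMod N)ˣ) (W : Matrix (Fin g) (Fin g) ℂ) (hW : W ∈ siegelUpperHalfSpace g),
        pts (AlgPoints.map (ιc c) (unif c W)) =
          SiegelShimuraSet.mk δ (principalLevelSubgroup δ N) ⟨jOfSiegel δ W, C0_subset_C0pm δ (jOfSiegel_mem_C0 hδ.1 hW)⟩ (rep c)) ∧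
    -- (A) admissibility of the universal triple at the image point ((U3∃)) and classification ((U3-D3))
      (∀ (v : Fin 2 → ℂ) (hv : v ∈ negCone (Jstar.map τ)) a, ∃ hZv : Z a v ∈ siegelUpperHalfSpace g,
        (∃ (P' : PolarizedAbelianSchemeWithLevel g N δ (specOver ℚ ℂ).left)
            (G : P'.A.X.left ⟶ 𝓜.univ.A.X.left) (Ĝ : P'.D.hat.X.left ⟶ 𝓜.univ.D.hat.X.left),
            P'.IsBaseChangeVia 𝓜.univ (f (ShimuraSetGS.mk L Jstar τ K v hv a)).left G Ĝ ∧
              IsAdmissibleAt hδ (rep (piece a)) (Z a v) hZv P') ∧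
        ∀ P' : PolarizedAbelianSchemeWithLevel g N δ (specOver ℚ ℂ).left, IsAdmissibleAt hδ (rep (piece a)) (Z a v) hZv P' →
          f (ShimuraSetGS.mk L Jstar τ K v hv a) = 𝓜.classifyingMap (specOver ℚ ℂ) P') := by
  classical
  -- the clauses of (U) at `𝓜`
  obtain ⟨Sc, ιc, unif, ⟨hc⟩, hirr, hU2, hU3⟩ := hU g N δ hg hδ hN 𝓜
  have hsurj : ∀ c, Set.SurjOn (unif c) (siegelUpperHalfSpace g) Set.univ := fun c => (hU2 c).2.2.1
  have hiff : ∀ c, ∀ W ∈ siegelUpperHalfSpace g, ∀ W' ∈ siegelUpperHalfSpace g,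
      unif c W = unif c W' ↔ ∃ M ∈ siegelLevelGroup δ N, ∃ C : (Fin g → ℂ) ≃ₗ[ℂ] (Fin g → ℂ),
        ∀ x : Fin g ⊕ Fin g → ℝ, C (siegelPeriodMap δ W x) = siegelPeriodMap δ W' (intAct M x) := fun c => (hU2 c).2.2.2.1
  -- FILE A over these pieces
  obtain ⟨f, piece, Z, u, rep, pts, hrep, hZd, hZm, hfmk, hptsf, hmkrep, hval⟩ :=
    exists_moduliPointMapGS J hJ b bq hg hδ hN hJneg hJsmul hb hJrat K hle hZ hc unif hsurj hiff
  refine ⟨Sc, ιc, unif, fun x => (AlgPoints.baseChangeEquiv (algebraMap ℚ ℂ) 𝓜.M).symm (f x), piece, Z, u, rep, pts,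
    ⟨hc⟩, hirr, fun c => (hU2 c).1, fun c => (hU2 c).2.1, hsurj, hiff, fun c => (hU2 c).2.2.2.2, hrep, hZd, hZm,
    fun v hv a => congrArg (AlgPoints.baseChangeEquiv (algebraMap ℚ ℂ) 𝓜.M).symm (hfmk v hv a),
    fun v hv a => by show pts (AlgPoints.baseChangeEquiv _ 𝓜.M ((AlgPoints.baseChangeEquiv _ 𝓜.M).symm (f _))) = _;
                     rw [Equiv.apply_symm_apply, hptsf], hmkrep, hval,
    fun v hv a => ?_⟩
  -- (U3) at `(piece a, u (piece a), rep (piece a))` and `Z a v`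
  obtain ⟨hu1, hu2, hr1, hr2, hr3⟩ := hrep (piece a)
  have h3 := hU3 (piece a) (u (piece a)) (rep (piece a)) hu1 hu2 hr1 hr2 hr3 (Z a v) (hZm a v hv)
  refine ⟨hZm a v hv, ?_, fun P' hP' => ?_⟩
  · obtain ⟨P', G, Ĝ, hbc, hadm⟩ := h3.1
    refine ⟨P', G, Ĝ, ?_, hadm⟩
    simp only [hfmk]
    exact hbc
  · show (AlgPoints.baseChangeEquiv (algebraMap ℚ ℂ) 𝓜.M).symm (f _) = _
    rw [Equiv.symm_apply_eq, hfmk]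
    exact h3.2 P' hP'

end UnitaryCurve

end Literature.AlgebraicGeometry.ShimuraVarieties

end
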